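import Mathlib
import Literature.NumberTheory.Transcendental.KZSemiCanonicalReductionProofs
import Literature.NumberTheory.Transcendental.KZSemiCanonicalReductionDimOne
import Summits.KontsevichZagierPeriods.KontsevichZagierPeriods.Theorems.InverseLandauTateLiftingDimOneUnitKernel

/-!
# `TateLifting` (stmt-KontsevichZagierPeriods-9129), line `Sketch` — stub `stub_dimOneAlgCompactify`

COMPACTIFICATION WITH ALGEBRAIC COEFFICIENTS (Viu-Sos' step (a) in dimension one). A
one-dimensional representation `r` whose integrand reads `p(x₀)/q(x₀)` on its domain, with
`p, q ∈ ℝ[x]` having real-ALGEBRAIC coefficients and `q ≠ 0` on the domain, differs by relations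
from a finite sum of representations of the same shape (algebraic coefficients, non-vanishing
denominator on the domain) whose domains are BOUNDED.

Proof (the template is `KZ.exists_sub_sum_bounded_mem_relations`, the `ℚ`-coefficient case, whose
chart API `PeriodCompactify.*` of `PeriodCompactDomain.lean` is reused with `n = 1`).
* Split `r.domain ⊆ ℝ¹` into its traces on the outer regions `outer T` (`T : Finset (Fin 1)`, i.e.
  `|x₀| < 1` for `T = ∅` and `|x₀| > 1` for `T = {0}`): iterated domain additivity
  (`KZ.of_sub_sum_of_mem_relations`, rule 1a; the complement `{|x₀| = 1}` is null and the traces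
  are disjoint).
* On each trace change variables by the involutive chart `inv T` (`x₀ ↦ 1/x₀` on the coordinates
  in `T`; rule 2, a `KZ.changeOfVariablesRel` witness): the new domain `pieceDom T r.domain` lies
  in `[-1, 1]`, and the Jacobian-weighted pull-back of `p/q` is again a quotient of real polynomials
  with algebraic coefficients, non-vanishing denominator on the piece: `p/q` itself for `T = ∅`,
  and `p̃(y)/(q̃(y) y²)` with `p̃ = reflect N p`, `q̃ = reflect N q` (`N ≥ deg p, deg q`;
  `(reflect N f)(y) = f(1/y) yᴺ`, Mathlib's `Polynomial.eval₂_reflect_mul_pow`) for `T = {0}`.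
* Re-index the `2` pieces by `Fin k`.

References: J. Viu-Sos, *A semi-canonical reduction for periods of Kontsevich–Zagier*, Int. J.
Number Theory 17 (2021), Thm. 2.1 and Cor. 2.1; M. Kontsevich, D. Zagier, *Periods* (2001), §1.2,
rules (1), (2).
-/

noncomputable section

open MeasureTheory Set Polynomial
open Literature.NumberTheory.Transcendental
open Literature.NumberTheory.Transcendental.PeriodCompactify hiding reflect
open Literature.ModelTheory.ExponentialFields (IsSemialgebraic isSemialgebraic_univ)

namespace Summit.KontsevichZagierPeriods.InverseLandau

namespace DimOne

/-! ### Reflected real polynomials with algebraic coefficients -/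

/-- Evaluation of a reflected polynomial off the origin: `(reflect N f)(y) = f(1/y) · yᴺ`
(`N ≥ deg f`). [folklore] -/
theorem cpa_eval_reflect {f : ℝ[X]} {N : ℕ} (hf : f.natDegree ≤ N) {y : ℝ} (hy : y ≠ 0) :
    (reflect N f).eval y = f.eval y⁻¹ * y ^ N := by
  letI : Invertible y⁻¹ := invertibleOfNonzero (inv_ne_zero hy)
  have h := eval₂_reflect_mul_pow (RingHom.id ℝ) y⁻¹ N f hf
  rw [invOf_eq_inv, _root_.inv_inv, eval₂_id, eval₂_id] at h
  rw [← h, mul_assoc, ← mul_pow, inv_mul_cancel₀ hy, one_pow, mul_one]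

/-- The reflected polynomial has algebraic coefficients if the polynomial has. [folklore] -/
theorem cpa_algCoeff_reflect {f : ℝ[X]} (hf : ∀ i, IsAlgebraic ℚ (f.coeff i)) (N : ℕ) :
    ∀ i, IsAlgebraic ℚ ((reflect N f).coeff i) := fun i => by
  rw [coeff_reflect]
  exact hf _

/-- `f · Xⁿ` has algebraic coefficients if `f` has. [folklore] -/
theorem cpa_algCoeff_mul_X_pow {f : ℝ[X]} (hf : ∀ i, IsAlgebraic ℚ (f.coeff i)) (n : ℕ) :
    ∀ i, IsAlgebraic ℚ ((f * X ^ n).coeff i) := fun i => by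
  rw [coeff_mul_X_pow']
  split_ifs
  · exact hf _
  · exact isAlgebraic_zero

/-! ### The two charts of `ℝ¹` -/

/-- A finite set of `Fin 1` containing `0` is everything. [folklore] -/
theorem cpa_eq_univ {T : Finset (Fin 1)} (h0 : (0 : Fin 1) ∈ T) : T = Finset.univ :=
  Finset.eq_univ_of_forall fun i => by
    rw [Fin.fin_one_eq_zero i]
    exact h0

/-- A finite set of `Fin 1` not containing `0` is empty. [folklore] -/
theorem cpa_eq_empty {T : Finset (Fin 1)} (h0 : (0 : Fin 1) ∉ T) : T = ∅ :=
  Finset.eq_empty_of_forall_notMem fun i hi => h0 (by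
    rw [Fin.fin_one_eq_zero i] at hi
    exact hi)

/-- The chart of the empty set of coordinates is the identity. [folklore] -/
theorem cpa_inv_empty (v : Fin 1 → ℝ) : inv (∅ : Finset (Fin 1)) v = v :=
  funext fun i => inv_apply_of_not_mem ∅ (Finset.notMem_empty i) v

/-- **The piece data.** For every `T : Finset (Fin 1)` there are real polynomials `P, Q` with
algebraic coefficients, `Q ≠ 0` on the piece domain `pieceDom T r.domain`, such that the
Jacobian-weighted pull-back of `p/q` along `inv T` is `P/Q` there: `P/Q = p/q` for `T = ∅`
(`inv ∅ = id`, Jacobian `1`), and `P = reflect N p`, `Q = reflect N q · X²` for `T = {0}`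
(`x₀ = 1/y₀`, Jacobian `1/y₀²`). [cite: ViuSos2021, Thm. 2.1 and Cor. 2.1] -/
theorem cpa_pieceData (r : KZ.IntegralRep 1) (p q : ℝ[X]) (hp : ∀ i, IsAlgebraic ℚ (p.coeff i))
    (hq : ∀ i, IsAlgebraic ℚ (q.coeff i)) (hq0 : ∀ x ∈ r.domain, q.eval (x 0) ≠ 0)
    (hpq : EqOn r.integrand (fun x => p.eval (x 0) / q.eval (x 0)) r.domain)
    (T : Finset (Fin 1)) :
    ∃ P Q : ℝ[X], (∀ i, IsAlgebraic ℚ (P.coeff i)) ∧ (∀ i, IsAlgebraic ℚ (Q.coeff i)) ∧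
      (∀ v ∈ pieceDom T r.domain, Q.eval (v 0) ≠ 0) ∧
      ∀ v ∈ pieceDom T r.domain,
        P.eval (v 0) / Q.eval (v 0) = r.integrand (inv T v) * |(invDeriv T v).det| := by
  by_cases h0 : (0 : Fin 1) ∈ T
  · obtain rfl := cpa_eq_univ h0
    set N : ℕ := max p.natDegree q.natDegree with hN
    have hpN : p.natDegree ≤ N := le_max_left _ _
    have hqN : q.natDegree ≤ N := le_max_right _ _
    -- on the piece: `y₀ ≠ 0`, `1/y₀ ∈ r.domain`
    have key : ∀ v ∈ pieceDom (Finset.univ : Finset (Fin 1)) r.domain,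
        v 0 ≠ 0 ∧ inv Finset.univ v 0 = (v 0)⁻¹ ∧ inv Finset.univ v ∈ r.domain := fun v hv =>
      ⟨ne_zero_of_mem_inner Finset.univ hv.1 (Finset.mem_univ 0),
        inv_apply_of_mem Finset.univ (Finset.mem_univ 0) v, hv.2⟩
    have hQev : ∀ y : ℝ, y ≠ 0 →
        (reflect N q * X ^ 2).eval y = q.eval y⁻¹ * y ^ N * y ^ 2 := fun y hy => by
      rw [eval_mul, eval_pow, eval_X, cpa_eval_reflect hqN hy]
    refine ⟨reflect N p, reflect N q * X ^ 2, cpa_algCoeff_reflect hp N,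
      cpa_algCoeff_mul_X_pow (cpa_algCoeff_reflect hq N) 2, fun v hv => ?_, fun v hv => ?_⟩
    · obtain ⟨hy, hinv, hmem⟩ := key v hv
      have hqy : q.eval (v 0)⁻¹ ≠ 0 := by
        rw [← hinv]
        exact hq0 _ hmem
      rw [hQev _ hy]
      exact mul_ne_zero (mul_ne_zero hqy (pow_ne_zero _ hy)) (pow_ne_zero _ hy)
    · obtain ⟨hy, hinv, hmem⟩ := key v hv
      have hqy : q.eval (v 0)⁻¹ ≠ 0 := by
        rw [← hinv]
        exact hq0 _ hmem
      rw [hpq hmem, abs_det_invDeriv, Fin.prod_univ_one]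
      beta_reduce
      rw [hinv, hQev _ hy, cpa_eval_reflect hpN hy]
      field_simp
  · obtain rfl := cpa_eq_empty h0
    refine ⟨p, q, hp, hq, fun v hv => ?_, fun v hv => ?_⟩
    · have hmem : v ∈ r.domain := by simpa [pieceDom, cpa_inv_empty] using hv.2
      exact hq0 v hmem
    · have hmem : v ∈ r.domain := by simpa [pieceDom, cpa_inv_empty] using hv.2
      rw [cpa_inv_empty, abs_det_invDeriv, Finset.prod_empty, mul_one]
      exact (hpq hmem).symm

/-- **One piece as ONE change of variables.** Given the piece data `P/Q` on `pieceDom T r.domain`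
(algebraic coefficients, `Q ≠ 0` there, `P/Q` the Jacobian-weighted pull-back of the integrand
of `r` along `inv T`), the honest representation `ρ = [pieceDom T r.domain, P/Q]` (integrable by
Mathlib's `integrableOn_image_iff_integrableOn_abs_det_fderiv_smul`) satisfies
`[ρ] − [S] ∈ changeOfVariablesRel ⊆ relations` for the trace `S` of `r` on `outer T`.
[cite: ViuSos2021, Thm. 2.1 and Cor. 2.1] -/
theorem cpa_piece (r S : KZ.IntegralRep 1) (T : Finset (Fin 1))
    (hSd : S.domain = r.domain ∩ outer T) (hSi : S.integrand = r.integrand) {P Q : ℝ[X]}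
    (hP : ∀ i, IsAlgebraic ℚ (P.coeff i)) (hQ : ∀ i, IsAlgebraic ℚ (Q.coeff i))
    (hQ0 : ∀ v ∈ pieceDom T r.domain, Q.eval (v 0) ≠ 0)
    (hid : ∀ v ∈ pieceDom T r.domain,
      P.eval (v 0) / Q.eval (v 0) = r.integrand (inv T v) * |(invDeriv T v).det|) :
    ∃ ρ : KZ.IntegralRep 1, ρ.domain = pieceDom T r.domain ∧
      ρ.integrand = (fun v => P.eval (v 0) / Q.eval (v 0)) ∧ KZ.of ρ - KZ.of S ∈ KZ.relations := by
  have hσ := r.isSemialgebraic_domain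
  have hD : IsSemialgebraic ℚ (pieceDom T r.domain) := isSemialgebraic_pieceDom T hσ
  have hDm : MeasurableSet (pieceDom T r.domain) := measurableSet_pieceDom T hσ
  have hsa : IsSemialgebraicFunOn ℚ (pieceDom T r.domain)
      (fun v => P.eval (v 0) / Q.eval (v 0)) :=
    (rp_isSemialgebraicFunOn_eval hD hP).div (rp_isSemialgebraicFunOn_eval hD hQ) hQ0
  have hint : IntegrableOn (fun v => P.eval (v 0) / Q.eval (v 0)) (pieceDom T r.domain) := by
    have h := (integrableOn_image_iff_integrableOn_abs_det_fderiv_smul volume hDm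
      (hasFDerivWithinAt_inv_pieceDom T) (injOn_inv_pieceDom T) r.integrand).1 (by
        rw [image_inv_pieceDom]
        exact r.integrableOn.mono_set inter_subset_left)
    refine h.congr_fun (fun v hv => ?_) hDm
    simp only [smul_eq_mul]
    rw [mul_comm]
    exact (hid v hv).symm
  refine ⟨⟨pieceDom T r.domain, fun v => P.eval (v 0) / Q.eval (v 0), hD, hsa, hint⟩, rfl, rfl,
    ?_⟩
  refine KZ.changeOfVariablesRel_subset_relations
    ⟨1, _, S, inv T, invDeriv T, KZ.isSemialgebraicMapOn_inv_pieceDom T hσ,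
      hasFDerivWithinAt_inv_pieceDom T, injOn_inv_pieceDom T, ?_, fun v hv => ?_, rfl⟩
  · rw [hSd]
    exact (image_inv_pieceDom T).symm
  · rw [hSi]
    exact hid v hv

end DimOne

/-- **COMPACTIFICATION WITH ALGEBRAIC COEFFICIENTS** (stub `stub_dimOneAlgCompactify` of the line
`Sketch` of `TateLifting`, i.e. the body of `DimOneAlgCompactify`; Viu-Sos' step (a) in dimension
one). A one-dimensional representation with integrand `p(x₀)/q(x₀)` on its domain (`p, q ∈ ℝ[x]`
with real-algebraic coefficients, `q ≠ 0` on the domain) differs by relations from a finite sum of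
representations of the same shape on BOUNDED domains: split the domain along `|x₀| = 1` (rule 1,
null complement) and invert `x₀ ↦ 1/x₀` on the outer piece (rule 2); the new integrand
`p(1/y)/q(1/y) · y⁻² = p̃(y)/(q̃(y) y²)` (`p̃ = reflect N p`, `q̃ = reflect N q`) has algebraic
coefficients and `q̃(y) y² ≠ 0` on the piece. [cite: ViuSos2021, Thm. 2.1 and Cor. 2.1] -/
theorem tateLifting_dimOneAlgCompactify :
    ∀ (r : KZ.IntegralRep 1) (p q : Polynomial ℝ), (∀ i, IsAlgebraic ℚ (p.coeff i)) →
      (∀ i, IsAlgebraic ℚ (q.coeff i)) → (∀ x ∈ r.domain, q.eval (x 0) ≠ 0) →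
      Set.EqOn r.integrand (fun x => p.eval (x 0) / q.eval (x 0)) r.domain →
      ∃ (k : ℕ) (ρ : Fin k → KZ.IntegralRep 1) (P Q : Fin k → Polynomial ℝ),
        (∀ j, Bornology.IsBounded (ρ j).domain) ∧
        (∀ j i, IsAlgebraic ℚ ((P j).coeff i)) ∧ (∀ j i, IsAlgebraic ℚ ((Q j).coeff i)) ∧
        (∀ j, ∀ x ∈ (ρ j).domain, (Q j).eval (x 0) ≠ 0) ∧
        (∀ j, Set.EqOn (ρ j).integrand (fun x => (P j).eval (x 0) / (Q j).eval (x 0)) (ρ j).domain) ∧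
        KZ.of r - ∑ j, KZ.of (ρ j) ∈ KZ.relations := by
  intro r p q hp hq hq0 hpq
  classical
  have hσ := r.isSemialgebraic_domain
  -- the traces of `r` on the outer regions (rule 1)
  have hS : ∀ T : Finset (Fin 1), IsSemialgebraic ℚ (r.domain ∩ outer T) := fun T =>
    hσ.inter (isSemialgebraic_outer T)
  set S : Finset (Fin 1) → KZ.IntegralRep 1 := fun T => r.restrict _ (hS T) inter_subset_left
    with hS'
  have e1 : KZ.of r - ∑ T, KZ.of (S T) ∈ KZ.relations := by
    refine KZ.of_sub_sum_of_mem_relations Finset.univ r S (fun T _ => ?_) (fun T _ _ _ => rfl)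
      ?_ ?_
    · rw [show (S T).domain \ r.domain = ∅ from sdiff_eq_empty.mpr inter_subset_left,
        measure_empty]
    · refine measure_mono_null (fun x hx => ?_) volume_compl_iUnion_outer
      intro hx'
      obtain ⟨T, hT⟩ := mem_iUnion.1 hx'
      exact hx.2 (mem_biUnion (Finset.mem_univ T) ⟨hx.1, hT⟩)
    · intro T hT T' hT' hne
      rw [show (S T).domain ∩ (S T').domain = ∅ from
        Set.disjoint_iff_inter_eq_empty.mp (pairwiseDisjoint_outer r.domain hT hT' hne),
        measure_empty]
  -- the pieces (rule 2)
  choose P Q hPa hQa hQ0 hid using DimOne.cpa_pieceData r p q hp hq hq0 hpq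
  choose ρ hρd hρi hρrel using fun T =>
    DimOne.cpa_piece r (S T) T rfl rfl (hPa T) (hQa T) (hQ0 T) (hid T)
  have e2 : ∑ T, KZ.of (ρ T) - ∑ T, KZ.of (S T) ∈ KZ.relations :=
    KZ.sum_sub_sum_mem_relations Finset.univ _ _ fun T _ => hρrel T
  have e3 : KZ.of r - ∑ T, KZ.of (ρ T) ∈ KZ.relations := by
    have : KZ.of r - ∑ T, KZ.of (ρ T) =
        (KZ.of r - ∑ T, KZ.of (S T)) - (∑ T, KZ.of (ρ T) - ∑ T, KZ.of (S T)) := by abel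
    rw [this]
    exact KZ.relations.sub_mem e1 e2
  -- re-index by `Fin k`
  set e := Fintype.equivFin (Finset (Fin 1)) with he
  refine ⟨Fintype.card (Finset (Fin 1)), fun j => ρ (e.symm j), fun j => P (e.symm j),
    fun j => Q (e.symm j), fun j => ?_, fun j => hPa _, fun j => hQa _, fun j x hx => ?_,
    fun j x hx => ?_, ?_⟩
  · rw [hρd]
    exact isBounded_pieceDom _
  · rw [hρd] at hx
    exact hQ0 _ x hx
  · rw [hρi]
  · rw [Equiv.sum_comp e.symm (fun T => KZ.of (ρ T))]
    exact e3

end Summit.KontsevichZagierPeriods.InverseLandau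

end
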